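import Summits.QuantumFields.BalabanUV.T4Continuum.Support.T4TrajectoryDensityDressedLoop

/-!
# `T4Continuum.T4TrajectoryDensityFresh` — the (w2-obs) clause LOCALISED: the oscillation the dressed pipeline pays for
# is the FRESH-FLUCTUATION RESPONSE of the carried observable-attached terms, nothing else (part 3 of the (w2)-split;
# parts 1–2 = `T4TrajectoryDensityDressed{,Loop}`) (cell `pub-balaban`, sub-cell `t4`, spine estimate NE1′ (node O3b/H2),
# lineage t4-ne1p-p1 = PROVER seat P1, technique «RG-trajectory comparison: extend B12's (2.18) inductive representation
# term by term with the observable insertion, tracking μ-uniformity through the printed small-field bounds», generation 22;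
# tree target `Summits/QuantumFields/BalabanUV/T4Continuum/Support/`; ADDITIVE — imports part 2 ONLY and modifies nothing)

HONEST FRAMING.  Finite four-torus, rung (B)+1 only (the `ε → 0` limit of unit-scale averaged loop expectations on ONE
torus of fixed size) — NOT infinite volume, NOT a mass gap, NOT the Clay problem, NOT summit progress.  «continuum YM on
T⁴ ⇐ BetaPertH ∧ nine spine estimates (0/9 proved); BetaPertH ⇐ (D1) ∧ (D4) ∧ CAP+tail; G-an2-4 gates asym, D1 and
NE2/3/4».  ABSOLUTE RULE honoured: every declaration below is [folklore] kernel mathematics (projective invariance of a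
normalised integral, the Cauchy estimate along a complex segment, the triangle inequality, geometric series), 0 sorry,
0 citations; the printed kernels (1.73)–(1.75) of [Balaban1989LargeFieldII] p. 380 enter only BY NAME through the
imported leaves.  NOTHING is said about Bałaban's densities: whether they and the cell's observable-attached terms meet the
hypothesis shapes is NOT PRINTED and is the cell wall of record `t4/T4-EST-NE1p-P1.md` §4.

WHY THIS LEAF (record `t4/T4-EST-NE1p-P1.md`, generation 22; wall clause (w2-obs)).  Part 2 §8 typed the exact missing
inequality of the μ-UNIFORM clause as OBS-SUM — a K-uniform bound `Σ_{k<K} s₁ k ≤ S₁` on the oscillation budgets `s₁ k`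
of the observable-attached exponent `𝒬 k` in the dressed capstone's binder `hP` — and proved that, if `s₁ k` is charged
as the FULL slice size of the carried terms (part 2 §5, `pertSlice_of_birthSlice_shift`: size `A`, about the constant `0`),
the admissible source strength shrinks with `K` (`source_bound_noContraction`).  This leaf shows that the full size is NOT
what the pipeline pays for.  Three steps, all [folklore]:

* §9 EXACT RECENTRING.  The normalised operation `wOp ω μ z₀ U` sees the weight only through its slice at `U`, and is
  invariant under rescaling that slice by a nonzero constant (part 1 `wOp_const_mul`); hence a fluctuation-CONSTANT but
  arbitrarily BACKGROUND-DEPENDENT addition `q U` to the exponent is invisible: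
  `wOp (base·e^{−(𝒜 + q)}) = wOp (base·e^{−𝒜})` EXACTLY (`wOp_expWeight_add_zconst`).  So the dressed capstone holds with
  `hP` asked only of the CENTRED exponent `𝒬 k U z − q k U`, `q k` free (`transportsFromVar_of_centredExponent_lattice`):
  the response of the observable-attached exponent to the COMPLEX CHART MOTION OF THE BACKGROUND costs nothing — only its
  oscillation in the FRESH fluctuation variable `z`, at each (complex) background, is paid for.
* §10 THE FRESH SUPPLIER.  With `q U := 𝒬 U z₁` (value at a reference fluctuation `z₁ ∈ D`), the centred exponent of a
  carried term `G` is `G (U + z) − G (U + z₁)`: a DIFFERENCE AT A FLUCTUATION PAIR over one background.  If the pair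
  `(W + z₁, W + z)` is in relative gauge of defect `δ` for the backgrounds `W = move U₀ d t` of the complex chart (a
  complex window margin (N2ᶜ): `move U₀ d t + z₁` stays in the coarse window for `t` in the tube), the birth-chart
  transport lemma (`T4BirthChartTransport.transport_of_birthChart`, Cauchy along the slice + gauge quotient) bounds it by
  `(4A/r)·δ` — so the centred perturbation slice has size `(4A/r)·δ` (`pertSlice_fresh`), raw form `δ = θ` = the
  fluctuation diameter (`pertSlice_fresh_lattice`, defect witnessed by the bond field `z − z₁` itself), sums over the
  live families with the source strength as a factor (`pertSlice_fresh_sum`, `dressedExponent_split`).  THE DEFECT `δ` OF A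
  FRESH PAIR is, in raw form, EXACTLY the fluctuation diameter `θ_k` of the capstone's `hdiam` (the object in the window
  factor `1 + 4θ_k/ϱ` of `hdom`), and in gauge-quotient form a binder of the (I4′) TYPE that `hrate` carries (defect
  `≤ c_δ ψ^{k−k′}` in the generation chart); no new KIND of input enters.
* §11 THE SCALAR BOOTSTRAP (companion leaf `T4TrajectoryDensityFreshBudget`, scalar only).  With `s₁ k = m·Σ_live (4A/r)·δ`
  (`m ∝ |μ|`), the carried sizes `A` grow only by the step
  factors `e^{3(s⁰+s₁)}` (part 2 §6/§8), the fresh defects decay like the transport rate and the births like `τ^{K−j}`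
  (the UNDRESSED profile `γ k = Σ_{j≤k} N₀Λ^{k−j}·c_δψ^{k−j}·Âτ^{K−j}`, summable down the tower under the O-G2 strict
  product `Λψτ ≤ ρ < 1`: `freshProfile_sum_le`, a double geometric series, K-FREE), the budgets obey the self-consistent
  law `s₁ k ≤ m·e^{3(S₀ + Σ_{i<k} s₁ i)}·γ k`, and `obsSum_of_bootstrap` closes it: `m·e^{3(S₀+1)}·Γ ≤ 1 ⟹ Σ_{k<K} s₁ k ≤ 1`
  for EVERY `K` — OBS-SUM with `S₁ = 1`, the smallness being a K-FREE condition on the source strength (`Γ` the K-free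
  profile sum, `S₀` the summed ACTION oscillation at the family's met steps = binder (w2-act)/(w4)).  Part 2's
  `source_bound_noContraction` is thereby identified as an artefact of the crude supplier, not an obstruction.

WHAT THIS DOES TO THE WALL (record §4, honest accounting).  (w2-obs) = OBS-SUM is no longer an independent clause: it is
REDUCED to (i) fresh-pair defects of (I4′) type (the type `hrate` already carries), (ii) births (I3) `Â·τ^{K−j}`, (iii) the
positional count and the O-G2 strict product (w7), (iv) a radius floor (free: part 2 §6 loses any `ϱ < r` per step at no
cost in size), the complex window margin (N2ᶜ) and CROSS-FAMILY nesting (the transported family's fine window inside every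
live family's coarse window) — (w3)-type geometry, (v) the summed action oscillation `S₀` — (w2-act)/(w4), (vi)
|μ|-smallness — (w6).  Which families are live in the exponent of a met step (the finset `S`), the iteration of part 2 §6
along the trajectory that produces the current slice sizes (well-founded in `k`; NOT re-threaded into the capstone here),
and every one of (i)–(vi) for Bałaban's densities and the cell's D-terms, are NOT PRINTED and NOT asserted here; (w1),
(w2-act), (w3)–(w7) stand.
-/

namespace Summit.QuantumFields.BalabanUV.T4Continuum.T4TrajectoryDensityDressed

open MeasureTheory Set Metric Filter
open Literature.MathematicalPhysics.QuantumFieldTheory.Balaban1983to89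
open T4TermFormat T4TermFormat.Booking T4GatedBooking T4TrajectoryComparison T4TrajectoryModulus
open T4BirthChartTransport (GaugeInvariant BirthSlice RelGauge transport_of_birthChart)
open T4BlockTransport (Fld NDir latMove latN latMove_zero)
open T4TrajectoryDensity

noncomputable section

/-! ## §9 Exact recentring: fluctuation-constant parts of the exponent are invisible to the normalised operation [folklore] -/

section Recentre

variable {Z : Type*} [MeasurableSpace Z] {𝒰 : Type*} {F : Type*} [NormedAddCommGroup F] [NormedSpace ℂ F]

/-- `wOp ω μ z₀ U` depends on the weight only through its slice `ω U`. [folklore] -/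
theorem wOp_congr_at {ω ω' : 𝒰 → Z → ℂ} {μ : Measure Z} {z₀ : Z} {U : 𝒰} (h : ω U = ω' U) (g : Z → F) :
    wOp ω μ z₀ U g = wOp ω' μ z₀ U g := by
  unfold wOp
  rw [h]

omit [MeasurableSpace Z] in
/-- A fluctuation-constant addition `q U` to the exponent rescales the weight slice at `U` by the nonzero constant
`e^{−q U}`. [folklore] -/
theorem expWeight_add_zconst (base : Z → ℝ) (𝒜 : 𝒰 → Z → ℂ) (q : 𝒰 → ℂ) (U : 𝒰) :
    expWeight base (𝒜 + fun U _ => q U) U = fun z => Complex.exp (-q U) * expWeight base 𝒜 U z := by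
  funext z
  simp only [expWeight_apply, Pi.add_apply, neg_add, Complex.exp_add]
  ring

/-- **EXACT RECENTRING.**  `wOp (base·e^{−(𝒜 + q)}) μ z₀ U = wOp (base·e^{−𝒜}) μ z₀ U` for ANY fluctuation-constant,
background-dependent `q : 𝒰 → ℂ` — projective invariance of the normalised operation (`wOp_const_mul`) applied slice by
slice.  Consequence: of an observable-attached exponent only the oscillation in the FRESH fluctuation variable, at each
background separately, can ever be charged; its response to the motion of the background is free. [folklore] -/
theorem wOp_expWeight_add_zconst (base : Z → ℝ) (𝒜 : 𝒰 → Z → ℂ) (q : 𝒰 → ℂ) (μ : Measure Z) (z₀ : Z)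
    (U : 𝒰) (g : Z → F) :
    wOp (expWeight base (𝒜 + fun U _ => q U)) μ z₀ U g = wOp (expWeight base 𝒜) μ z₀ U g := by
  rw [wOp_congr_at (ω' := fun U' z => Complex.exp (-q U) * expWeight base 𝒜 U' z) (expWeight_add_zconst base 𝒜 q U) g]
  exact wOp_const_mul (Complex.exp_ne_zero _) _ μ z₀ U g

omit [MeasurableSpace Z] in
/-- THE SPLIT OF A DRESSED EXPONENT into its centred part and its fluctuation-constant part at a reference fluctuation
`z₁`: `c·Σ_i G_i (U + z) = c·Σ_i (G_i (U + z) − G_i (U + z₁)) + c·Σ_i G_i (U + z₁)`. [folklore] -/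
theorem dressedExponent_split {V : Type*} [Add V] {ι : Type*} (S : Finset ι) (G : ι → V → ℂ) (c : ℂ) (z₁ : V) :
    (fun U z => c * ∑ i ∈ S, G i (U + z)) =
      (fun U z => c * ∑ i ∈ S, (G i (U + z) - G i (U + z₁))) + fun U _ => c * ∑ i ∈ S, G i (U + z₁) := by
  funext U z
  simp only [Pi.add_apply, Finset.sum_sub_distrib]
  ring

end Recentre

/-! ## §10 The dressed capstone with a CENTRED perturbation slice; the fresh supplier [folklore] -/

section CapstoneCentred

variable {B : Booking} {T : Trajectory B}
variable {R : Type*} [NormedRing R] [NormedAlgebra ℂ R] [MeasurableSpace R] {d : ℕ}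
  {F : Type*} [NormedAddCommGroup F] [NormedSpace ℂ F] [CompleteSpace F]

/-- **THE DRESSED PIPELINE WITH A CENTRED PERTURBATION SLICE** — part 1's `transportsFromVar_of_dressedExponent_lattice`
VERBATIM except that the perturbation-slice binder `hP` is asked only of the CENTRED observable-attached exponent
`(U, z) ↦ 𝒬 k U z − q k U`, for an ARBITRARY fluctuation-constant part `q k : Fld d R → ℂ` (free data; typically
`q k U = 𝒬 k U (z₁ k)`), while the step law `hFn` keeps the full exponent `𝒜 k + 𝒬 k`.  Proof: §9's exact recentring
rewrites `hFn` with the centred exponent, then part 1 applies.  SAME conclusion. [folklore] -/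
theorem transportsFromVar_of_centredExponent_lattice {Gate : ℕ → Prop} {Fn : B.Birth → ℕ → ℕ → Fld d R → F}
    {rel : B.Birth → ℕ → ℕ → Fld d R → Fld d R → Prop} {𝒦 : B.Birth → ℕ → ℕ → Set (Fld d R)}
    {ref : ℕ → Fld d R → Fld d R} {base : ℕ → Fld d R → ℝ} {𝒜 𝒬 : ℕ → Fld d R → Fld d R → ℂ}
    {q : ℕ → Fld d R → ℂ}
    {μ : ℕ → Measure (Fld d R)} {z₀ : ℕ → Fld d R} {D : ℕ → Set (Fld d R)}
    {defect : B.Birth → ℕ → ℕ → ℝ} {cδ ψ w r : ℝ} {s s₁ α θ : ℕ → ℝ} {ϱ : B.Birth → ℕ → ℕ → ℝ}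
    (hα : ∀ i, 0 ≤ α i) (hr : 0 < r) (hw : 0 < w)
    (hsl : ∀ (b : B.Birth) (k' : ℕ), B.birthScale b ≤ k' → k' ≤ B.K → RanBelow Gate k' →
      BirthSlice (Fn b k' k') latMove latN (𝒦 b k' k') w r (T.gen b k'))
    (hFn : ∀ (b : B.Birth) (k' k : ℕ), B.birthScale b ≤ k' → k' ≤ k → k + 1 ≤ B.K → RanBelow Gate (k + 1) →
      ∀ U, Fn b k' (k + 1) U = wOp (expWeight (base k) (𝒜 k + 𝒬 k)) (μ k) (z₀ k) U (fun z => Fn b k' k (U + z)))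
    (h𝒢 : ∀ (b : B.Birth) (k' k : ℕ), B.birthScale b ≤ k' → k' ≤ k → k + 1 ≤ B.K → RanBelow Gate (k + 1) →
      ∀ U, (fun z => Fn b k' k (U + z)) ∈ BddClass F (μ k))
    (hD : ∀ k, (D k).Nonempty) (hϱ : ∀ b k' k, 0 < ϱ b k' k)
    (hB : ∀ (b : B.Birth) (k' k : ℕ), B.birthScale b ≤ k' → k' ≤ k → k + 1 ≤ B.K → RanBelow Gate (k + 1) →
      RealBaseAt (ref k) (base k) (𝒜 k) (μ k) (𝒦 b k' (k + 1)))
    (hE : ∀ (b : B.Birth) (k' k : ℕ), B.birthScale b ≤ k' → k' ≤ k → k + 1 ≤ B.K → RanBelow Gate (k + 1) →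
      ExponentSliceAt (ref k) (𝒜 k) (μ k) latMove latN (𝒦 b k' (k + 1)) w (ϱ b k' k) (s k))
    (hP : ∀ (b : B.Birth) (k' k : ℕ), B.birthScale b ≤ k' → k' ≤ k → k + 1 ≤ B.K → RanBelow Gate (k + 1) →
      PertSlice (fun U z => 𝒬 k U z - q k U) (μ k) latMove latN (𝒦 b k' (k + 1)) w (ϱ b k' k) (s₁ k))
    (hs : ∀ k, s k + s₁ k ≤ 1) (hDμ : ∀ k, ∀ᵐ z ∂μ k, z ∈ D k)
    (hN1 : ∀ (b : B.Birth) (k' k : ℕ), B.birthScale b ≤ k' → k' ≤ k → k + 1 ≤ B.K →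
      ∀ z ∈ D k, ∀ U ∈ 𝒦 b k' (k + 1), U + z ∈ 𝒦 b k' k)
    (hN2 : ∀ (b : B.Birth) (k' k : ℕ), B.birthScale b ≤ k' → k' ≤ k → k + 1 ≤ B.K →
      ∀ U₀ ∈ 𝒦 b k' (k + 1), ∀ p : NDir d R, latN p ≤ w → ∀ z' ∈ D k, latMove U₀ p 1 + z' ∈ 𝒦 b k' k)
    (hdiam : ∀ k, ∀ z ∈ D k, ∀ z' ∈ D k, ∀ x ν, ‖z x ν - z' x ν‖ ≤ θ k)
    (hθ : ∀ k, 0 < θ k ∧ θ k ≤ w)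
    (hdom : ∀ (b : B.Birth) (k' k : ℕ), B.birthScale b ≤ k' → k' ≤ k → k + 1 ≤ B.K →
      Real.exp (3 * (s k + s₁ k)) * (1 + 4 * θ k / ϱ b k' k) ≤ α k)
    (hinv : ∀ b k' k, GaugeInvariant (rel b k' k) (Fn b k' k))
    (hdefw : ∀ b k' k, defect b k' k ≤ w)
    (hrate : ∀ (b : B.Birth) (k' k : ℕ), B.birthScale b ≤ k' → k' ≤ k → k ≤ B.K →
      defect b k' k ≤ cδ * ψ ^ (k - k'))
    (hlin : ∀ (b : B.Birth) (k' k : ℕ), B.birthScale b ≤ k' → k' ≤ k → k ≤ B.K → RanBelow Gate k → ∀ ε > 0,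
      ∃ U₀ ∈ 𝒦 b k' k, ∃ U₁ : Fld d R, RelGauge (rel b k' k) latMove latN U₀ U₁ (defect b k' k) ∧
        T.lin b k' k ≤ ‖Fn b k' k U₁ - Fn b k' k U₀‖ + ε) :
    T.TransportsFromVar (4 * cδ / r) (fun i => ψ * α i) Gate := by
  have e : ∀ k, 𝒜 k + 𝒬 k = (𝒜 k + fun U z => 𝒬 k U z - q k U) + fun U _ => q k U := fun k => by
    funext U z
    simp only [Pi.add_apply]
    ring
  refine transportsFromVar_of_dressedExponent_lattice (𝒬 := fun k U z => 𝒬 k U z - q k U) (z₀ := z₀) hα hr hw hsl ?_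
    h𝒢 hD hϱ hB hE hP hs hDμ hN1 hN2 hdiam hθ hdom hinv hdefw hrate hlin
  intro b k' k h₁ h₂ h₃ h₄ U
  rw [hFn b k' k h₁ h₂ h₃ h₄ U, e k, wOp_expWeight_add_zconst]

end CapstoneCentred

section Fresh

/-- Monotonicity of the tube in its radius. [folklore] -/
theorem tube_mono {ρ ρ' : ℝ} (h : ρ ≤ ρ') : tube ρ ⊆ tube ρ' := by
  unfold tube
  exact thickening_mono h _

variable {V : Type*} [AddCommGroup V] [MeasurableSpace V] {Dir : Type*} {move : V → Dir → ℂ → V} {N : Dir → ℝ}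

/-- **THE FRESH SUPPLIER (gauge-quotient form).**  A carried term `G`, gauge invariant under `rel`, with a birth slice of
radius `r` and size `A` on the coarse window `𝒦big` along a translation-commuting chart starting at the base; radii
`ϱ < ϱ₁ ≤ r`, `0 < ϱ₁`; the a.e. nesting (N1); the COMPLEX WINDOW MARGIN (N2ᶜ) — the complex chart motions of radius
`ϱ₁` from the fine window, shifted by the reference fluctuation `z₁`, stay in `𝒦big`; and, for a.e. fresh fluctuation `z`,
the pair `(move U₀ d t + z₁, move U₀ d t + z)` in relative gauge of defect `δ ≤ w` over every background of the tube.
THEN the CENTRED term `(U, z) ↦ G (U + z) − G (U + z₁)` is a perturbation slice on the fine window `𝒦` of radius `ϱ` and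
size `(4A/r)·δ` (about the constant `0`): holomorphy in `t` of both summands as in part 2 §5, the bound by
`transport_of_birthChart` at the complex base `move U₀ d t + z₁`. [folklore] -/
theorem pertSlice_fresh {G : V → ℂ} {rel : V → V → Prop} {μ : Measure V} {𝒦 𝒦big : Set V} {z₁ : V}
    {w ϱ ϱ₁ r A δ : ℝ}
    (hmove : ∀ (U z : V) (d : Dir) (t : ℂ), move (U + z) d t = move U d t + z)
    (hmove0 : ∀ (U : V) (d : Dir), move U d 0 = U)
    (hinv : GaugeInvariant rel G) (hsl : BirthSlice G move N 𝒦big w r A) (hr : 0 < r) (hA : 0 ≤ A)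
    (hϱ : ϱ < ϱ₁) (hϱ₁ : 0 < ϱ₁) (hϱ₁r : ϱ₁ ≤ r)
    (hnest : ∀ᵐ z ∂μ, ∀ U₀ ∈ 𝒦, U₀ + z ∈ 𝒦big)
    (hnestC : ∀ U₀ ∈ 𝒦, ∀ d : Dir, 0 < N d → N d ≤ w → ∀ t ∈ tube (ϱ₁ / N d), move U₀ d t + z₁ ∈ 𝒦big)
    (hpair : ∀ U₀ ∈ 𝒦, ∀ d : Dir, 0 < N d → N d ≤ w →
      ∀ᵐ z ∂μ, ∀ t ∈ tube (ϱ₁ / N d), RelGauge rel move N (move U₀ d t + z₁) (move U₀ d t + z) δ)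
    (hδw : δ ≤ w) (hmeas : ∀ U, AEStronglyMeasurable (fun z => G (U + z)) μ) :
    PertSlice (fun U z => G (U + z) - G (U + z₁)) μ move N 𝒦 w ϱ (4 * A / r * δ) := by
  refine pertSlice_of_sup fun U₀ hU₀ d hd hdw => ?_
  have hsub : tube (ϱ₁ / N d) ⊆ tube (r / N d) := tube_mono (div_le_div_of_nonneg_right hϱ₁r hd.le)
  -- holomorphy of the reference summand along the chart, from the birth slice at the base `U₀ + z₁ ∈ 𝒦big`
  have hz₁ : U₀ + z₁ ∈ 𝒦big := by
    have h0 := hnestC U₀ hU₀ d hd hdw ((0 : ℝ) : ℂ) (ofReal_mem_tube (div_pos hϱ₁ hd) ⟨le_rfl, zero_le_one⟩)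
    rwa [Complex.ofReal_zero, hmove0] at h0
  have href : DifferentiableOn ℂ (fun t => G (move U₀ d t + z₁)) (tube (ϱ₁ / N d)) := by
    obtain ⟨Dm, hdiff, -, hDm⟩ := hsl (U₀ + z₁) hz₁ d hd hdw
    have e : (fun t => G (move U₀ d t + z₁)) = fun t => G (move (U₀ + z₁) d t) := by
      funext t
      rw [hmove]
    rw [e]
    exact hdiff.mono (hsub.trans (tube_subset hDm))
  refine ⟨tube (ϱ₁ / N d), isOpen_tube _, fun x hx => closedBall_subset_tube hd hϱ hx,
    fun t _ => (hmeas (move U₀ d t)).sub aestronglyMeasurable_const, ?_, ?_⟩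
  · filter_upwards [hnest] with z hz
    obtain ⟨Dm, hdiff, -, hDm⟩ := hsl (U₀ + z) (hz U₀ hU₀) d hd hdw
    have e : (fun t => G (move U₀ d t + z)) = fun t => G (move (U₀ + z) d t) := by
      funext t
      rw [hmove]
    have hmain : DifferentiableOn ℂ (fun t => G (move U₀ d t + z)) (tube (ϱ₁ / N d)) := by
      rw [e]
      exact hdiff.mono (hsub.trans (tube_subset hDm))
    exact hmain.sub href
  · filter_upwards [hpair U₀ hU₀ d hd hdw] with z hz t ht
    exact transport_of_birthChart hinv hsl hmove0 hr hA (hnestC U₀ hU₀ d hd hdw t ht) (hz t ht) hδw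

/-- **SUMS OVER THE LIVE FAMILIES, WITH THE SOURCE STRENGTH AS A FACTOR.**  If every live carried term's centred slice has
size `4 A_i / r_i · δ_i`, the centred observable-attached exponent `c·Σ_i (G_i (U + z) − G_i (U + z₁))` (`c` ∝ the source
strength `μ`) is a perturbation slice of size `‖c‖·Σ_i 4 A_i / r_i · δ_i` (part 1 `PertSlice.sum`, `.const_mul`).  With
`dressedExponent_split` this is exactly the `hP` of `transportsFromVar_of_centredExponent_lattice` for
`𝒬 U z = c·Σ_i G_i (U + z)`, `q U = c·Σ_i G_i (U + z₁)`. [folklore] -/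
theorem pertSlice_fresh_sum {ι : Type*} (S : Finset ι) {G : ι → V → ℂ} {μ : Measure V} {𝒦 : Set V} {z₁ : V}
    {w ϱ : ℝ} {A r δ : ι → ℝ} (c : ℂ)
    (h : ∀ i ∈ S, PertSlice (fun U z => G i (U + z) - G i (U + z₁)) μ move N 𝒦 w ϱ (4 * A i / r i * δ i)) :
    PertSlice (fun U z => c * ∑ i ∈ S, (G i (U + z) - G i (U + z₁))) μ move N 𝒦 w ϱ
      (‖c‖ * ∑ i ∈ S, 4 * A i / r i * δ i) :=
  (PertSlice.sum S h).const_mul c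

variable {R : Type*} [NormedRing R] [NormedAlgebra ℂ R] [MeasurableSpace R] {d : ℕ}

/-- **THE FRESH SUPPLIER ON `ℤ^d`, RAW FORM** (no gauge quotient: the defect of the fresh pair `(W + z₁, W + z)` is
witnessed by the bond field `z − z₁` itself, declared bound `θ` = the fluctuation diameter of the capstone's `hdiam`).
Inputs = the lattice capstone's own (N1), `hDμ`, `hdiam`, `hθ`, a reference fluctuation `z₁ ∈ D`, the birth slice of the
carried term on the coarse window, and the COMPLEX margin (N2ᶜ) (the capstone's (N2) is its `t = 1` case).  Size
`(4A/r)·θ`. [folklore] -/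
theorem pertSlice_fresh_lattice {G : Fld d R → ℂ} {μ : Measure (Fld d R)} {𝒦 𝒦big D : Set (Fld d R)}
    {z₁ : Fld d R} {w ϱ ϱ₁ r A θ : ℝ}
    (hsl : BirthSlice G latMove latN 𝒦big w r A) (hr : 0 < r) (hA : 0 ≤ A)
    (hϱ : ϱ < ϱ₁) (hϱ₁ : 0 < ϱ₁) (hϱ₁r : ϱ₁ ≤ r)
    (hDμ : ∀ᵐ z ∂μ, z ∈ D) (hz₁ : z₁ ∈ D) (hN1 : ∀ z ∈ D, ∀ U₀ ∈ 𝒦, U₀ + z ∈ 𝒦big)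
    (hN2c : ∀ U₀ ∈ 𝒦, ∀ p : NDir d R, 0 < latN p → latN p ≤ w →
      ∀ t ∈ tube (ϱ₁ / latN p), ∀ z ∈ D, latMove U₀ p t + z ∈ 𝒦big)
    (hdiam : ∀ z ∈ D, ∀ z' ∈ D, ∀ x ν, ‖z x ν - z' x ν‖ ≤ θ) (hθ : 0 < θ) (hθw : θ ≤ w)
    (hmeas : ∀ U, AEStronglyMeasurable (fun z => G (U + z)) μ) :
    PertSlice (fun U z => G (U + z) - G (U + z₁)) μ latMove latN 𝒦 w ϱ (4 * A / r * θ) := by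
  refine pertSlice_fresh (rel := fun U U' => U = U') latMove_add_right latMove_zero (fun _ _ h => by rw [h]) hsl hr hA
    hϱ hϱ₁ hϱ₁r (hDμ.mono fun z hz U₀ hU₀ => hN1 z hz U₀ hU₀)
    (fun U₀ hU₀ p hp hpw t ht => hN2c U₀ hU₀ p hp hpw t ht z₁ hz₁) (fun U₀ hU₀ p hp hpw => ?_) hθw hmeas
  filter_upwards [hDμ] with z hz t ht
  have hbd : ∀ x ν, ‖(z - z₁) x ν‖ ≤ θ := fun x ν => by simpa only [Pi.sub_apply] using hdiam z hz z₁ hz₁ x ν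
  refine ⟨fldDir (z - z₁) θ hbd, by simpa only [latN_fldDir] using hθ, by simp only [latN_fldDir, le_refl], ?_⟩
  rw [latMove_fldDir_one]
  abel

end Fresh

end

end Summit.QuantumFields.BalabanUV.T4Continuum.T4TrajectoryDensityDressed
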